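import Summits.Ventures.PercRepro.C041TriDomParallelEdge
import Summits.Ventures.PercRepro.C041TriDomTwoExitInduction

/-!
# ROW C-041 — THEOREM (PARALLEL PAIR) AND THE REDUCTION TO SIMPLE CORES, IN THE KERNEL
(p6, gen 46; P6-TWOEXIT-LEAN.md §53 ADDENDUM 17)

* **THEOREM (PARALLEL PAIR)** (`cycDominationS_of_parallel`, `sibDominationS_of_parallel`): for a parallel pair
  `f₁ = a–b`, `f₁' = a'–b'` (`Parallel`: both free, `a ≡ a'`, `b ≡ b'` through double edges), the statements on
  `st` follow from the statements on `stAbs st f₁` (`f₁` deleted) and on `stAbs (stCon st f₁) f₁'` (`f₁`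
  contracted, `f₁'` deleted) — THE TWO-EXIT COUNT with the connectivity identities of `C041TriDomParallelEdge`.
* **THEOREM (REDUCTION, SIMPLE FORM)** (`cyc_and_sib_of_simpleCore`, `cycDomination_of_simpleCore`): the conjecture
  and the sibling hold on every status as soon as they hold, for all marks, on every status without a cut, without a
  two-exit markless piece, without a redundant edge (`HasRedundant`: a free edge whose ends are joined by double edges
  — loops included) and without a parallel pair (`HasParallel`).  Every reduction lowers the measure `muTE` of
  `C041TriDomTwoExitInduction` (a deletion lowers the number of present edges).
READING: the open core of CONJECTURE (STOCHASTIC DOMINATION) is the statuses whose contracted multigraph is SIMPLE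
(no loop, no parallel edge), has no cut vertex separating marks and no markless lobe, and no unmarked vertex of
degree `≤ 2` — the diamond `K₄ − e` with the marks on the hub and the two degree-2 vertices is the smallest one.
-/

namespace PercRepro

namespace ZoneZ

namespace MultiExit

open ZoneData Finset

variable {V₁ E₁ U₁ U₂ : Type} (Z₁ : ZoneData V₁ E₁ U₁ U₂) [DecidableEq E₁]
variable {st : E₁ → EStat} {f₁ f₁' : E₁} {a b a' b' : V₁}

/-! ## THEOREM (PARALLEL PAIR) -/

/-- The crossed classes and `(⊤, ⊥)` of `st` are those of `stAbs st f₁` on the same-colour colourings. -/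
theorem cyc_same_of_parallel (hP : Parallel Z₁ st f₁ f₁' a b a' b') (x y z : V₁) (ω : E₁ → Bool)
    (h : ω f₁ = ω f₁') :
    (CycCrossedS Z₁ x y z st ω ↔ CycCrossedS Z₁ x y z (stAbs st f₁) ω) ∧
      (TopBotS Z₁ x y z st ω ↔ TopBotS Z₁ x y z (stAbs st f₁) ω) := by
  rw [cycCrossedS_iff, cycCrossedS_iff, topBotS_iff, topBotS_iff, RdS_parallel_same Z₁ hP ω h,
    MgS_parallel_same Z₁ hP ω h]
  exact ⟨Iff.rfl, Iff.rfl⟩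

/-- The crossed classes and `(⊤, ⊥)` of `st` are those of `stAbs (stCon st f₁) f₁'` on the mixed colourings. -/
theorem cyc_diff_of_parallel (hP : Parallel Z₁ st f₁ f₁' a b a' b') (x y z : V₁) (ω : E₁ → Bool)
    (h : ω f₁ ≠ ω f₁') :
    (CycCrossedS Z₁ x y z st ω ↔ CycCrossedS Z₁ x y z (stAbs (stCon st f₁) f₁') ω) ∧
      (TopBotS Z₁ x y z st ω ↔ TopBotS Z₁ x y z (stAbs (stCon st f₁) f₁') ω) := by
  rw [cycCrossedS_iff, cycCrossedS_iff, topBotS_iff, topBotS_iff, RdS_parallel_diff Z₁ hP ω h,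
    MgS_parallel_diff Z₁ hP ω h]
  exact ⟨Iff.rfl, Iff.rfl⟩

/-- The classes of `stAbs st f₁` ignore the colour of `f₁`. -/
theorem cyc_stAbs_congr (x y z : V₁) (ω ω' : E₁ → Bool) (h : ∀ e, e ≠ f₁ → ω e = ω' e) :
    (CycCrossedS Z₁ x y z (stAbs st f₁) ω ↔ CycCrossedS Z₁ x y z (stAbs st f₁) ω') ∧
      (TopBotS Z₁ x y z (stAbs st f₁) ω ↔ TopBotS Z₁ x y z (stAbs st f₁) ω') := by
  rw [cycCrossedS_iff, cycCrossedS_iff, topBotS_iff, topBotS_iff, RdS_stAbs_congr Z₁ h, MgS_stAbs_congr Z₁ h]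
  exact ⟨Iff.rfl, Iff.rfl⟩

/-- The classes of `stAbs (stCon st f₁) f₁'` ignore the colours of the pair. -/
theorem cyc_stAbsCon_congr (x y z : V₁) (ω ω' : E₁ → Bool) (h : ∀ e, ¬ (e = f₁ ∨ e = f₁') → ω e = ω' e) :
    (CycCrossedS Z₁ x y z (stAbs (stCon st f₁) f₁') ω ↔ CycCrossedS Z₁ x y z (stAbs (stCon st f₁) f₁') ω') ∧
      (TopBotS Z₁ x y z (stAbs (stCon st f₁) f₁') ω ↔ TopBotS Z₁ x y z (stAbs (stCon st f₁) f₁') ω') := by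
  rw [cycCrossedS_iff, cycCrossedS_iff, topBotS_iff, topBotS_iff, RdS_stAbsCon_congr Z₁ h,
    MgS_stAbsCon_congr Z₁ h]
  exact ⟨Iff.rfl, Iff.rfl⟩

/-- The sibling classes and target of `st` are those of `stAbs st f₁` on the same-colour colourings. -/
theorem sib_same_of_parallel (hP : Parallel Z₁ st f₁ f₁' a b a' b') (x y t : V₁) (ω : E₁ → Bool)
    (h : ω f₁ = ω f₁') :
    ((SibC₁ Z₁ x y t st ω ∨ SibC₃ Z₁ x y t st ω) ↔
        (SibC₁ Z₁ x y t (stAbs st f₁) ω ∨ SibC₃ Z₁ x y t (stAbs st f₁) ω)) ∧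
      (SibTop Z₁ x y t st ω ↔ SibTop Z₁ x y t (stAbs st f₁) ω) := by
  unfold SibC₁ SibC₃ SibTop
  rw [RdS_parallel_same Z₁ hP ω h, MgS_parallel_same Z₁ hP ω h]
  exact ⟨Iff.rfl, Iff.rfl⟩

/-- The sibling classes and target of `st` are those of `stAbs (stCon st f₁) f₁'` on the mixed colourings. -/
theorem sib_diff_of_parallel (hP : Parallel Z₁ st f₁ f₁' a b a' b') (x y t : V₁) (ω : E₁ → Bool)
    (h : ω f₁ ≠ ω f₁') :
    ((SibC₁ Z₁ x y t st ω ∨ SibC₃ Z₁ x y t st ω) ↔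
        (SibC₁ Z₁ x y t (stAbs (stCon st f₁) f₁') ω ∨ SibC₃ Z₁ x y t (stAbs (stCon st f₁) f₁') ω)) ∧
      (SibTop Z₁ x y t st ω ↔ SibTop Z₁ x y t (stAbs (stCon st f₁) f₁') ω) := by
  unfold SibC₁ SibC₃ SibTop
  rw [RdS_parallel_diff Z₁ hP ω h, MgS_parallel_diff Z₁ hP ω h]
  exact ⟨Iff.rfl, Iff.rfl⟩

/-- The sibling classes of `stAbs st f₁` ignore the colour of `f₁`. -/
theorem sib_stAbs_congr (x y t : V₁) (ω ω' : E₁ → Bool) (h : ∀ e, e ≠ f₁ → ω e = ω' e) :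
    ((SibC₁ Z₁ x y t (stAbs st f₁) ω ∨ SibC₃ Z₁ x y t (stAbs st f₁) ω) ↔
        (SibC₁ Z₁ x y t (stAbs st f₁) ω' ∨ SibC₃ Z₁ x y t (stAbs st f₁) ω')) ∧
      (SibTop Z₁ x y t (stAbs st f₁) ω ↔ SibTop Z₁ x y t (stAbs st f₁) ω') := by
  unfold SibC₁ SibC₃ SibTop
  rw [RdS_stAbs_congr Z₁ h, MgS_stAbs_congr Z₁ h]
  exact ⟨Iff.rfl, Iff.rfl⟩

/-- The sibling classes of `stAbs (stCon st f₁) f₁'` ignore the colours of the pair. -/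
theorem sib_stAbsCon_congr (x y t : V₁) (ω ω' : E₁ → Bool) (h : ∀ e, ¬ (e = f₁ ∨ e = f₁') → ω e = ω' e) :
    ((SibC₁ Z₁ x y t (stAbs (stCon st f₁) f₁') ω ∨ SibC₃ Z₁ x y t (stAbs (stCon st f₁) f₁') ω) ↔
        (SibC₁ Z₁ x y t (stAbs (stCon st f₁) f₁') ω' ∨ SibC₃ Z₁ x y t (stAbs (stCon st f₁) f₁') ω')) ∧
      (SibTop Z₁ x y t (stAbs (stCon st f₁) f₁') ω ↔ SibTop Z₁ x y t (stAbs (stCon st f₁) f₁') ω') := by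
  unfold SibC₁ SibC₃ SibTop
  rw [RdS_stAbsCon_congr Z₁ h, MgS_stAbsCon_congr Z₁ h]
  exact ⟨Iff.rfl, Iff.rfl⟩

section Parallel

variable [Fintype E₁]

open Classical in
/-- **THEOREM (PARALLEL PAIR)**: CONJECTURE (STOCHASTIC DOMINATION) on a status with a parallel pair follows from the
conjecture with one edge of the pair deleted and with it contracted and the other deleted. -/
theorem cycDominationS_of_parallel (hP : Parallel Z₁ st f₁ f₁' a b a' b') (x y z : V₁)
    (h₀ : CycDominationS Z₁ x y z (stAbs (stCon st f₁) f₁')) (h₁ : CycDominationS Z₁ x y z (stAbs st f₁)) :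
    CycDominationS Z₁ x y z st := by
  intro V hV
  exact dom_of_twoExit_count hP.hne (Src := CycCrossedS Z₁ x y z) (Tgt := TopBotS Z₁ x y z)
    (fun ω h => cyc_same_of_parallel Z₁ hP x y z ω h) (fun ω h => cyc_diff_of_parallel Z₁ hP x y z ω h)
    (fun ω ω' h => cyc_stAbs_congr Z₁ x y z ω ω' h) (fun ω ω' h => cyc_stAbsCon_congr Z₁ x y z ω ω' h) h₀ h₁ V hV

open Classical in
/-- **THEOREM (PARALLEL PAIR)** for the sibling domination. -/
theorem sibDominationS_of_parallel (hP : Parallel Z₁ st f₁ f₁' a b a' b') (x y t : V₁)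
    (h₀ : SibDominationS Z₁ x y t (stAbs (stCon st f₁) f₁')) (h₁ : SibDominationS Z₁ x y t (stAbs st f₁)) :
    SibDominationS Z₁ x y t st := by
  intro V hV
  have key := dom_of_twoExit_count hP.hne (Src := fun st ω => SibC₁ Z₁ x y t st ω ∨ SibC₃ Z₁ x y t st ω)
    (Tgt := SibTop Z₁ x y t)
    (fun ω h => sib_same_of_parallel Z₁ hP x y t ω h) (fun ω h => sib_diff_of_parallel Z₁ hP x y t ω h)
    (fun ω ω' h => sib_stAbs_congr Z₁ x y t ω ω' h) (fun ω ω' h => sib_stAbsCon_congr Z₁ x y t ω ω' h)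
    (fun V hV => (card_filter_inst.trans_le (h₀ V hV)).trans_eq card_filter_inst)
    (fun V hV => (card_filter_inst.trans_le (h₁ V hV)).trans_eq card_filter_inst) V hV
  exact (card_filter_inst.trans_le key).trans_eq card_filter_inst

end Parallel

/-! ## The reduction to simple cores -/

variable (st)

/-- The status has a redundant edge: a free edge whose ends are joined by double edges (loops included). -/
def HasRedundant : Prop := ∃ (f : E₁) (a b : V₁), st f = EStat.free ∧ Z₁.Joins f a b ∧ DConn Z₁ st a b

/-- The status has a parallel pair. -/
def HasParallel : Prop := ∃ (f₁ f₁' : E₁) (a b a' b' : V₁), Parallel Z₁ st f₁ f₁' a b a' b'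

/-- A present edge of `stAbs` is a present edge of `st` other than `f`. -/
theorem presE_stAbs {st : E₁ → EStat} {f e : E₁} (h : presE (stAbs st f) e) : presE st e ∧ e ≠ f := by
  unfold presE stAbs at h
  by_cases he : e = f
  · rw [if_pos he] at h
    exact absurd rfl h
  · rw [if_neg he] at h
    exact ⟨h, he⟩

omit [DecidableEq E₁] in
/-- A free edge is present. -/
theorem presE_of_free {st : E₁ → EStat} {f : E₁} (hf : st f = EStat.free) : presE st f := by
  unfold presE
  rw [hf]
  decide

section Measure

variable [Fintype E₁]

open Classical in
/-- Deleting a present edge lowers the number of present edges. -/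
theorem npres_stAbs_lt {st : E₁ → EStat} {f : E₁} (hf : presE st f) : npres (stAbs st f) < npres st := by
  unfold npres
  apply Finset.card_lt_card
  rw [Finset.ssubset_iff_subset_ne]
  constructor
  · intro e he
    rw [Finset.mem_filter] at he ⊢
    exact ⟨Finset.mem_univ _, (presE_stAbs he.2).1⟩
  · intro heq
    have hp : f ∈ univ.filter fun e => presE st e := by
      rw [Finset.mem_filter]
      exact ⟨Finset.mem_univ _, hf⟩
    rw [← heq, Finset.mem_filter] at hp
    exact (presE_stAbs hp.2).2 rfl

open Classical in
/-- The measure drops under the deletion of a free edge. -/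
theorem μ_stAbs_lt {st : E₁ → EStat} {f : E₁} (hf : st f = EStat.free) : muTE (stAbs st f) < muTE st :=
  μ_lt_of_npres_lt st (npres_stAbs_lt (presE_of_free hf))

open Classical in
/-- The measure drops under the contraction of one edge of a parallel pair and the deletion of the other. -/
theorem μ_stAbsCon_lt {st : E₁ → EStat} {f₁ f₁' : E₁} (hne : f₁ ≠ f₁') (hs₁ : st f₁ = EStat.free)
    (hs₁' : st f₁' = EStat.free) : muTE (stAbs (stCon st f₁) f₁') < muTE st := by
  have h1 : muTE (stAbs (stCon st f₁) f₁') < muTE (stCon st f₁) := by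
    refine μ_stAbs_lt ?_
    unfold stCon
    rw [if_neg hne.symm]
    exact hs₁'
  exact h1.trans (μ_stCon_lt hs₁)

end Measure

section Induction

variable [Fintype E₁]

open Classical in
/-- The induction step at a status with a redundant edge. -/
theorem step_of_hasRedundant (a b c : V₁) (h : HasRedundant Z₁ st)
    (ih : ∀ st' : E₁ → EStat, muTE st' < muTE st → ∀ a' b' c' : V₁,
      CycDominationS Z₁ a' b' c' st' ∧ SibDominationS Z₁ a' b' c' st') :
    CycDominationS Z₁ a b c st ∧ SibDominationS Z₁ a b c st := by
  obtain ⟨f, p, q, hf, hj, hpq⟩ := h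
  have IH := ih (stAbs st f) (μ_stAbs_lt hf) a b c
  exact ⟨cycDominationS_of_redundant Z₁ hf hj hpq a b c IH.1, sibDominationS_of_redundant Z₁ hf hj hpq a b c IH.2⟩

open Classical in
/-- The induction step at a status with a parallel pair. -/
theorem step_of_hasParallel (a b c : V₁) (h : HasParallel Z₁ st)
    (ih : ∀ st' : E₁ → EStat, muTE st' < muTE st → ∀ a' b' c' : V₁,
      CycDominationS Z₁ a' b' c' st' ∧ SibDominationS Z₁ a' b' c' st') :
    CycDominationS Z₁ a b c st ∧ SibDominationS Z₁ a b c st := by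
  obtain ⟨f₁, f₁', p, q, p', q', hP⟩ := h
  have IH₀ := ih (stAbs (stCon st f₁) f₁') (μ_stAbsCon_lt hP.hne hP.hs₁ hP.hs₁') a b c
  have IH₁ := ih (stAbs st f₁) (μ_stAbs_lt hP.hs₁) a b c
  exact ⟨cycDominationS_of_parallel Z₁ hP a b c IH₀.1 IH₁.1, sibDominationS_of_parallel Z₁ hP a b c IH₀.2 IH₁.2⟩

open Classical in
/-- **THEOREM (REDUCTION, SIMPLE FORM)**: if the conjecture and the sibling domination hold, for all marks, on every
status without a cut, without a two-exit markless piece, without a redundant edge and without a parallel pair, they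
hold on every status. -/
theorem cyc_and_sib_of_simpleCore
    (hbase : ∀ st : E₁ → EStat, ∀ a b c : V₁, ¬ HasCut Z₁ st a b c → ¬ HasTwoExit Z₁ st a b c →
      ¬ HasRedundant Z₁ st → ¬ HasParallel Z₁ st →
      CycDominationS Z₁ a b c st ∧ SibDominationS Z₁ a b c st) :
    ∀ st : E₁ → EStat, ∀ a b c : V₁, CycDominationS Z₁ a b c st ∧ SibDominationS Z₁ a b c st := by
  intro st
  suffices h : ∀ n : ℕ, ∀ st : E₁ → EStat, muTE st = n → ∀ a b c : V₁,
      CycDominationS Z₁ a b c st ∧ SibDominationS Z₁ a b c st from h _ st rfl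
  intro n
  induction n using Nat.strong_induction_on with
  | _ n ih =>
    intro st hst a b c
    have ih' : ∀ st' : E₁ → EStat, muTE st' < muTE st → ∀ a' b' c' : V₁,
        CycDominationS Z₁ a' b' c' st' ∧ SibDominationS Z₁ a' b' c' st' :=
      fun st' hlt => ih (muTE st') (hst ▸ hlt) st' rfl
    by_cases hcut : HasCut Z₁ st a b c
    · exact step_of_hasCut Z₁ st a b c hcut fun st' hlt => ih' st' (μ_lt_of_npres_lt st hlt)
    · by_cases h2 : HasTwoExit Z₁ st a b c
      · exact step_of_hasTwoExit Z₁ st a b c h2 ih'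
      · by_cases h3 : HasRedundant Z₁ st
        · exact step_of_hasRedundant Z₁ st a b c h3 ih'
        · by_cases h4 : HasParallel Z₁ st
          · exact step_of_hasParallel Z₁ st a b c h4 ih'
          · exact hbase st a b c hcut h2 h3 h4

open Classical in
/-- CONJECTURE (STOCHASTIC DOMINATION) on the all-free host, from the simple cores. -/
theorem cycDomination_of_simpleCore
    (hbase : ∀ st : E₁ → EStat, ∀ a b c : V₁, ¬ HasCut Z₁ st a b c → ¬ HasTwoExit Z₁ st a b c →
      ¬ HasRedundant Z₁ st → ¬ HasParallel Z₁ st →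
      CycDominationS Z₁ a b c st ∧ SibDominationS Z₁ a b c st) (x y z : V₁) :
    CycDomination Z₁ x y z :=
  (cyc_and_sib_of_simpleCore Z₁ hbase (fun _ => EStat.free) x y z).1

end Induction

end MultiExit

end ZoneZ

end PercRepro
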